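import Summits.QuantumFields.YangMills.Theorems.BalabanUVNodesN07H1OfRecordReality
import HarnessLib

/-!
# NODE N07 — THE `𝒢`-SLOT AND THE SLOT-(c) LETTERS OF def-Y's SCHEME OF RECORD ARE REAL: `𝔊(U₀; Δ₁) = G₁𝔓*` in the (115) reading, print's `π = 1 − DG′RD*`, the slot-(c)
# Hessian `π†(Δ(U₀) + Δ⁽²⁾)π`, the concrete `G′ = (Δ_{U₀} + a·proj_{N(Q′♭)ᗮ})⁻¹`, `H₁` at slot (c), and the log-coordinate `B(V)` ([B9] p. 392; [15] (20), (103), (110)–(111), (116))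

Cell `pub-ymgap`, width seat `pub-ymgap-dag-n07-w3` (g26), CLAIM-8.  `--kind proof --supports stmt-QuantumFields-27238 --as helper`; count-neutral.
[B9] = [Balaban1985BackgroundPropagators]; [15] = [Balaban1985Variational].

WHY.  def-Y g38's `Node00/BgSchemeChartLie` (INTENT-A) reads `ChartSUTok` from ROWS «the operators are real»: `𝒢 V` maps real currents to real jets, `𝔄 V` is real, `J V`
is real, `W V` maps real to real — plus Prop. 6's regime.  This file supplies the record-side facts behind the `𝒢` row and the `𝔄` row at a guarded `SU(N)` background:
the (115)-typed `𝔊(U₀; Δ₁) = frakGOfRecordAt … Δ₁ (Q(U₀)) (Q′♭) a hpos hQ` (lit `frakGLatticeCLM`: `G₁x − G₁Q†K⁻¹QG₁x − G₁DRD*G₁x` read on the functions) maps the bondwise conjugate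
current `fᴴ` to the conjugate jet `(𝔊f)ᴴ` for every REAL Hessian slot `Δ₁` (✓p821508 ∕ ✓p821715: `G₁`, `Q`, `Q†`, `K⁻¹`, `D`, `R`, `D*` real); the slot-(c) data are real when
`G′`, `Δ⁽²⁾` are (`π = 1 − DG′RD*`, `π†(Δ + Δ⁽²⁾)π`; the (3.134) `Δ⁽²⁾` is real by ✓p821783 ∕ the `…QuadPartReality` sequel); the concrete `G′` of ✓p819210 is real; and the
log-coordinate `B(V)(c) = (1/i)log(V(c)Ū(c)⋆)` is Hermitian within `1/4` of `1` (lit ✓`B7Prop2Explicit.star_mlog_eq_neg`).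
* §1 `funEquiv_starW`, ★★`equiv_frakGOfRecordAt_star` (any real `Δ₁`; guard), `equiv_frakGOfRecordAtBgFlat_star` (slot (a)).
* §2 `piOfRecord_starW` (real `G′`), `hessOpOfRecord128_starW` (real `G′`, `Δ⁽²⁾`), `kerOrthProj_starW` (`proj_{N(Q′♭)ᗮ}` real), `printGreenOfRecord_starW` (the concrete `G′` real),
  ★★`equiv_frakGOfRecordAtBg128_star`, ★★`equiv_H1OfRecordAtBg128_star` (slot (c)).
* §3 `star_BOfRecord_apply` (`B(V)(c)` Hermitian when `‖V(c)Ū(c)⋆ − 1‖ ≤ 1/4`), ★★`equiv_frakAOfRecordAtBg128_star` (`𝔄(V) = H₁B(V)` has Hermitian jet under that smallness).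

HONEST LABELS.  `*`-algebra bookkeeping; the guard, `hpos`, `hQ`, the smallness of `V(c)Ū(c)⋆ − 1` are displayed; TRACELESSNESS (the other half of the `𝔰𝔲(N)` rows) and the
`W` row are NOT here.  Count-neutral; N07 NOT discharged; P0 ⟨26900⟩ OPEN; R4 is the conditional finite-𝕋⁴ rung only.  Nothing here is a claim about the Yang–Mills
mass gap (`Summit.QuantumFields`): finite torus, fixed `ε`; nothing continuum ∕ OS ∕ Clay.
-/

set_option autoImplicit false

noncomputable section

open scoped Matrix Matrix.Norms.L2Operator InnerProductSpace ComplexConjugate BigOperators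

namespace Summit.QuantumFields.YangMills.Theorems.N07FrakGOfRecordReality

open Literature.MathematicalPhysics.QuantumFieldTheory.Balaban1983to89
open Literature.MathematicalPhysics.QuantumFieldTheory.Balaban1983to89.T4Continuum (T4Family)
open T4Continuum BlockAveraging
open B4Sect5Torus (TSite)
open B9SectCLatticeCarrier (Bond)
open B9Eq311L2Pairing (WL2)
open B9Eq311TracePairing (starW equiv_starW apply_equiv_starW starW_starW inner_starW_left)
open B11Eq103H1Complex (SiteL2K BondL2K covDerivL2K covDivL2K covLaplaceSiteK greenK G1LatticeK KinvLatticeK funEquiv funEquiv_apply funEquiv_symm_apply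
  readFun readFun_apply G1Fun QFun QadjFun DFun DstarFun frakGLatticeCLM)
open B11Eq115Space (NegSup NegSize levWeight JetSup)
open B11Eq111FrakG (nabla115 frakG frakG_apply frakGLin frakGLin_apply)
open B9Eq3119DeltaPiReality (real_comp real_add real_sub real_id real_smul_ofReal real_adjoint real_greenK real_starProjection)
open MatrixLog (mlog)
open Node00
open Summit.QuantumFields.YangMills.Theorems.N07HessOpOfRecordSymmetric (tauRec_star tauRec_mul_comm)
open Summit.QuantumFields.YangMills.Theorems.N07RecordLettersReality (hessOpOfRecord_starW covDerivL2K_ofRecord_starW covDivL2K_ofRecord_starW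
  covLaplaceSiteK_ofRecord_starW QflatOfRecord_starW_eq_zero RrOfRecord_QflatOfRecord_starW QOfRecord_starW)
open Summit.QuantumFields.YangMills.Theorems.N07H1OfRecordReality (adjoint_QOfRecord_starW laplaceAOfRecordAt_starW G1LatticeK_ofRecord_starW
  KinvLatticeK_ofRecord_starW funEquiv_symm_star equiv_H1OfRecordAt_star)

variable (F : T4Family) (N : ℕ) [NeZero N] {K : ℕ} (k : ℕ) (U₀ : GaugeField (F.P K) 0 (SU N)) [Fact (0 < c0Rec F K k)]
  [Fact (∀ c, 0 < wBRec F K k c)]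

/-! ## §1  `𝔊(U₀; Δ₁)` in the (115) reading is real -/

omit [NeZero N] [Fact (0 < c0Rec F K k)] [Fact (∀ c, 0 < wBRec F K k c)] in
/-- Reading a conjugate vector as a function gives the conjugate function: `φ ∘ f⋆ = (φ ∘ f)ᴴ`. [cite: Balaban1985Averaging, (18)–(19) p.21 (bookkeeping)] -/
theorem funEquiv_starW {ι : Type*} (w : ι → ℝ) (x : WL2 ℂ w (WRec N)) : funEquiv (phiRec N) w (starW (phiRec N) x) = star (funEquiv (phiRec N) w x) := by
  funext i
  rw [funEquiv_apply, Pi.star_apply, funEquiv_apply, apply_equiv_starW]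

section Slot

variable [Fact (0 < (F.L : ℝ))] [Fact (0 < (F.P K).eta k)] (Ω : ℕ → Set (Site (F.P K) 0))
  {Δ₁ : BondL2K ℂ (F.P K).d (fun _ => (F.P K).sitesPerDir 0) (c0Rec F K k) (WRec N) →ₗ[ℂ]
    BondL2K ℂ (F.P K).d (fun _ => (F.P K).sitesPerDir 0) (c0Rec F K k) (WRec N)} {a : ℝ}
  (hpos : ∀ x, x ≠ 0 → 0 < RCLike.re ⟪x, laplaceAOfRecordAt F N k U₀ Δ₁ (QOfRecord F N k U₀) (QflatOfRecord F N k) a x⟫_ℂ)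

set_option maxRecDepth 16384 in
/-- ★★ **`𝔊(U₀; Δ₁)` OF RECORD IN THE TYPE OF (115) IS REAL** for every REAL Hessian slot `Δ₁`, under the guard: the jet `𝔊 fᴴ` of the bondwise conjugate current is the
bondwise conjugate of the jet `𝔊 f` (`𝔊 = G₁ − G₁Q†K⁻¹QG₁ − G₁DRD*G₁` read on the functions, every factor real).
[cite: Balaban1985Variational, (110)–(111) p.294, (116)–(117) p.295; Balaban1985BackgroundPropagators, (3.153) p.426, p.392] -/
theorem equiv_frakGOfRecordAt_star (h : SmallBelow (avOfRecord F N K) k U₀) (hΔ₁ : ∀ x, Δ₁ (starW (phiRec N) x) = starW (phiRec N) (Δ₁ x))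
    (hQ : Function.Surjective (QOfRecord F N k U₀)) (f : NegSizeLit F N K k Ω 3) (b : Bond (F.P K).d (fun _ => (F.P K).sitesPerDir 0)) :
    JetSup.equiv _ _ (nabla115 ((F.P K).eta k) (unitsOfRecord F N U₀))
        (frakGOfRecordAt F N K k Ω U₀ Δ₁ (QOfRecord F N k U₀) (QflatOfRecord F N k) a hpos hQ ((NegSup.equiv _ _).symm (star (NegSup.equiv _ _ f)))) b =
      star (JetSup.equiv _ _ (nabla115 ((F.P K).eta k) (unitsOfRecord F N U₀))
        (frakGOfRecordAt F N K k Ω U₀ Δ₁ (QOfRecord F N k U₀) (QflatOfRecord F N k) a hpos hQ f) b) := by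
  -- the real letters, Hilbert level, read on the functions
  have hG := G1LatticeK_ofRecord_starW F N k U₀ hpos h hΔ₁
  have hK : ∀ y, KinvLatticeK hpos hQ (starW (phiRec N) y) = starW (phiRec N) (KinvLatticeK hpos hQ y) := KinvLatticeK_ofRecord_starW F N k U₀ hpos h hΔ₁ hQ
  have hR : ∀ s, RrOfRecord F N k U₀ (QflatOfRecord F N k) (starW (phiRec N) s) = starW (phiRec N) (RrOfRecord F N k U₀ (QflatOfRecord F N k) s) :=
    RrOfRecord_QflatOfRecord_starW F N k U₀
  have h1 : ∀ g : Bond (F.P K).d (fun _ => (F.P K).sitesPerDir 0) → Matrix (Fin N) (Fin N) ℂ,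
      readFun (phiRec N) (fun _ : Bond (F.P K).d (fun _ => (F.P K).sitesPerDir 0) => c0Rec F K k) (fun _ => c0Rec F K k) (G1LatticeK hpos) (star g) =
        star (readFun (phiRec N) (fun _ : Bond (F.P K).d (fun _ => (F.P K).sitesPerDir 0) => c0Rec F K k) (fun _ => c0Rec F K k) (G1LatticeK hpos) g) :=
    fun g => by rw [readFun_apply, readFun_apply, funEquiv_symm_star, hG, funEquiv_starW]
  have h2 : ∀ g : Bond (F.P K).d (fun _ => (F.P K).sitesPerDir 0) → Matrix (Fin N) (Fin N) ℂ,
      QOfRecord F N k U₀ ((funEquiv (phiRec N) (fun _ : Bond (F.P K).d (fun _ => (F.P K).sitesPerDir 0) => c0Rec F K k)).symm (star g)) =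
        starW (phiRec N) (QOfRecord F N k U₀ ((funEquiv (phiRec N) (fun _ : Bond (F.P K).d (fun _ => (F.P K).sitesPerDir 0) => c0Rec F K k)).symm g)) :=
    fun g => by rw [funEquiv_symm_star, QOfRecord_starW F N k U₀ h]
  have h3 : ∀ y : WL2 ℂ (wBRec F K k) (WRec N),
      funEquiv (phiRec N) (fun _ : Bond (F.P K).d (fun _ => (F.P K).sitesPerDir 0) => c0Rec F K k) (LinearMap.adjoint (QOfRecord F N k U₀) (starW (phiRec N) y)) =
        star (funEquiv (phiRec N) (fun _ : Bond (F.P K).d (fun _ => (F.P K).sitesPerDir 0) => c0Rec F K k) (LinearMap.adjoint (QOfRecord F N k U₀) y)) :=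
    fun y => by rw [adjoint_QOfRecord_starW F N k U₀ h, funEquiv_starW]
  have h5 : ∀ s : SiteL2K ℂ (F.P K).d (fun _ => (F.P K).sitesPerDir 0) (c0Rec F K k) (WRec N),
      funEquiv (phiRec N) (fun _ : Bond (F.P K).d (fun _ => (F.P K).sitesPerDir 0) => c0Rec F K k)
          (covDerivL2K ℂ (c0Rec F K k) (cRec F K k) (RRec F N U₀) (starW (phiRec N) s)) =
        star (funEquiv (phiRec N) (fun _ : Bond (F.P K).d (fun _ => (F.P K).sitesPerDir 0) => c0Rec F K k)
          (covDerivL2K ℂ (c0Rec F K k) (cRec F K k) (RRec F N U₀) s)) :=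
    fun s => by rw [covDerivL2K_ofRecord_starW F N k U₀, funEquiv_starW]
  have h7 : ∀ g : Bond (F.P K).d (fun _ => (F.P K).sitesPerDir 0) → Matrix (Fin N) (Fin N) ℂ,
      covDivL2K ℂ (c0Rec F K k) (cRec F K k) (SRec F N U₀)
          ((funEquiv (phiRec N) (fun _ : Bond (F.P K).d (fun _ => (F.P K).sitesPerDir 0) => c0Rec F K k)).symm (star g)) =
        starW (phiRec N) (covDivL2K ℂ (c0Rec F K k) (cRec F K k) (SRec F N U₀)
          ((funEquiv (phiRec N) (fun _ : Bond (F.P K).d (fun _ => (F.P K).sitesPerDir 0) => c0Rec F K k)).symm g)) :=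
    fun g => by rw [funEquiv_symm_star, covDivL2K_ofRecord_starW F N k U₀]
  unfold frakGOfRecordAt frakGLatticeCLM
  rw [frakG_apply, frakG_apply, Equiv.apply_symm_apply]
  simp only [frakGLin_apply, Pi.sub_apply, Pi.star_apply, star_sub, G1Fun, QFun, QadjFun, DFun, DstarFun, LinearMap.comp_apply, LinearEquiv.coe_coe,
    h1, h2, h3, hK, h5, hR, h7]

set_option maxRecDepth 16384 in
/-- **SLOT (a): `𝔊(U₀)` AT THE BARE HESSIAN (`frakGOfRecordAtBgFlat`) IS REAL** under the guard. [cite: Balaban1985Variational, (116)–(117) p.295] -/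
theorem equiv_frakGOfRecordAtBgFlat_star (h : SmallBelow (avOfRecord F N K) k U₀) {a : ℝ}
    (hposb : ∀ x, x ≠ 0 → 0 < RCLike.re ⟪x, laplaceAOfRecord F N k U₀ (QOfRecord F N k U₀) (QflatOfRecord F N k) a x⟫_ℂ)
    (hQ : Function.Surjective (QOfRecord F N k U₀)) (f : NegSizeLit F N K k Ω 3) (b : Bond (F.P K).d (fun _ => (F.P K).sitesPerDir 0)) :
    JetSup.equiv _ _ (nabla115 ((F.P K).eta k) (unitsOfRecord F N U₀))
        (frakGOfRecordAtBgFlat F N K k Ω U₀ a hposb hQ ((NegSup.equiv _ _).symm (star (NegSup.equiv _ _ f)))) b =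
      star (JetSup.equiv _ _ (nabla115 ((F.P K).eta k) (unitsOfRecord F N U₀)) (frakGOfRecordAtBgFlat F N K k Ω U₀ a hposb hQ f) b) :=
  equiv_frakGOfRecordAt_star F N k U₀ Ω hposb h (hessOpOfRecord_starW F N k U₀) hQ f b

end Slot

/-! ## §2  The slot-(c) data: `π`, `π†(Δ + Δ⁽²⁾)π`, the concrete `G′`, and `𝔊`, `H₁` at slot (c) -/

section SlotC

variable {F' : Type*} [AddCommGroup F'] [Module ℂ F']
  {Gp : SiteL2K ℂ (F.P K).d (fun _ => (F.P K).sitesPerDir 0) (c0Rec F K k) (WRec N) →ₗ[ℂ]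
    SiteL2K ℂ (F.P K).d (fun _ => (F.P K).sitesPerDir 0) (c0Rec F K k) (WRec N)}
  {Δ2 : BondL2K ℂ (F.P K).d (fun _ => (F.P K).sitesPerDir 0) (c0Rec F K k) (WRec N) →ₗ[ℂ]
    BondL2K ℂ (F.P K).d (fun _ => (F.P K).sitesPerDir 0) (c0Rec F K k) (WRec N)}

omit [NeZero N] [Fact (∀ c, 0 < wBRec F K k c)] in
/-- **PRINT'S `π = 1 − D G′ R D*` IS REAL FOR A REAL `G′`** (at `Q′ := Q′♭`). [cite: Balaban1985BackgroundPropagators, (3.119) p.419] -/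
theorem piOfRecord_starW (hGp : ∀ s, Gp (starW (phiRec N) s) = starW (phiRec N) (Gp s))
    (x : BondL2K ℂ (F.P K).d (fun _ => (F.P K).sitesPerDir 0) (c0Rec F K k) (WRec N)) :
    piOfRecord F N k U₀ Gp (QflatOfRecord F N k) (starW (phiRec N) x) = starW (phiRec N) (piOfRecord F N k U₀ Gp (QflatOfRecord F N k) x) := by
  unfold piOfRecord
  exact real_sub (phiRec N) (real_id (phiRec N))
    (real_comp (phiRec N) (covDerivL2K_ofRecord_starW F N k U₀)
      (real_comp (phiRec N) hGp (real_comp (phiRec N) (RrOfRecord_QflatOfRecord_starW F N k U₀) (covDivL2K_ofRecord_starW F N k U₀)))) x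

omit [NeZero N] [Fact (∀ c, 0 < wBRec F K k c)] in
/-- **THE SLOT-(c) HESSIAN `π†(Δ(U₀) + Δ⁽²⁾)π` IS REAL FOR REAL `G′`, `Δ⁽²⁾`.** [cite: Balaban1985BackgroundPropagators, (3.128) p.421, (3.135) p.422] -/
theorem hessOpOfRecord128_starW (hGp : ∀ s, Gp (starW (phiRec N) s) = starW (phiRec N) (Gp s)) (hΔ2 : ∀ x, Δ2 (starW (phiRec N) x) = starW (phiRec N) (Δ2 x))
    (x : BondL2K ℂ (F.P K).d (fun _ => (F.P K).sitesPerDir 0) (c0Rec F K k) (WRec N)) :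
    hessOpOfRecord128 F N k U₀ Gp (QflatOfRecord F N k) Δ2 (starW (phiRec N) x) = starW (phiRec N) (hessOpOfRecord128 F N k U₀ Gp (QflatOfRecord F N k) Δ2 x) := by
  unfold hessOpOfRecord128
  exact real_comp (phiRec N)
    (real_adjoint (phiRec N) (tauRec N) inner_phiRec_symm (tauRec_star N) (tauRec_mul_comm N) (piOfRecord_starW F N k U₀ hGp))
    (real_comp (phiRec N) (real_add (phiRec N) (hessOpOfRecord_starW F N k U₀) hΔ2) (piOfRecord_starW F N k U₀ hGp)) x

omit [NeZero N] [Fact (∀ c, 0 < wBRec F K k c)] in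
/-- **THE PINNING PROJECTION `proj_{N(Q′♭)ᗮ}` IS REAL** (`N(Q′♭)` is `⋆`-invariant, so is its orthogonal complement — `⋆` is anti-unitary). [cite: Balaban1985BackgroundPropagators, (3.24) p.394] -/
theorem kerOrthProj_starW [(LinearMap.ker (QflatOfRecord F N (K := K) k)).HasOrthogonalProjection]
    (s : SiteL2K ℂ (F.P K).d (fun _ => (F.P K).sitesPerDir 0) (c0Rec F K k) (WRec N)) :
    (LinearMap.ker (QflatOfRecord F N (K := K) k))ᗮ.starProjection (starW (phiRec N) s) =
      starW (phiRec N) ((LinearMap.ker (QflatOfRecord F N (K := K) k))ᗮ.starProjection s) := by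
  refine real_starProjection (phiRec N) (tauRec N) inner_phiRec_symm (tauRec_star N) (tauRec_mul_comm N) _ (fun g hg => ?_) s
  rw [Submodule.mem_orthogonal'] at hg ⊢
  intro u hu
  have hu' : starW (phiRec N) u ∈ LinearMap.ker (QflatOfRecord F N (K := K) k) := by
    rw [LinearMap.mem_ker] at hu ⊢
    exact QflatOfRecord_starW_eq_zero F N k hu
  rw [inner_starW_left (phiRec N) (tauRec N) inner_phiRec_symm (tauRec_star N) (tauRec_mul_comm N), hg _ hu', map_zero]

omit [NeZero N] [Fact (∀ c, 0 < wBRec F K k c)] in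
/-- **THE CONCRETE `G′ = (Δ_{U₀} + a·proj_{N(Q′♭)ᗮ})⁻¹` OF ✓`…N07PrintProjectionOfRecord` IS REAL.** [cite: Balaban1985BackgroundPropagators, (3.24)–(3.25) p.394] -/
theorem printGreenOfRecord_starW [(LinearMap.ker (QflatOfRecord F N (K := K) k)).HasOrthogonalProjection] (a' : ℝ)
    (hpos' : ∀ x, x ≠ 0 → 0 < RCLike.re ⟪x, (covLaplaceSiteK (c₀ := c0Rec F K k) (cRec F K k) (RRec F N U₀) (SRec F N U₀) +
      (a' : ℂ) • ((LinearMap.ker (QflatOfRecord F N (K := K) k))ᗮ.starProjection : _ →L[ℂ] _).toLinearMap) x⟫_ℂ)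
    (s : SiteL2K ℂ (F.P K).d (fun _ => (F.P K).sitesPerDir 0) (c0Rec F K k) (WRec N)) :
    greenK _ hpos' (starW (phiRec N) s) = starW (phiRec N) (greenK _ hpos' s) :=
  real_greenK (phiRec N) hpos'
    (real_add (phiRec N) (covLaplaceSiteK_ofRecord_starW F N k U₀) (real_smul_ofReal (phiRec N) (kerOrthProj_starW F N k) a')) s

variable [Fact (0 < (F.L : ℝ))] [Fact (0 < (F.P K).eta k)] (Ω : ℕ → Set (Site (F.P K) 0)) {a : ℝ}
  (hposπ : ∀ x, x ≠ 0 → 0 < RCLike.re ⟪x, laplaceAOfRecordAt F N k U₀ (hessOpOfRecord128 F N k U₀ Gp (QflatOfRecord F N k) Δ2)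
    (QOfRecord F N k U₀) (QflatOfRecord F N k) a x⟫_ℂ)

set_option maxRecDepth 16384 in
/-- ★★ **SLOT (c): `𝔊(U₀) = frakGOfRecordAtBg128` IS REAL** for real `G′`, `Δ⁽²⁾`, under the guard. [cite: Balaban1985Variational, (110)–(111) p.294, (116) p.295; Balaban1985BackgroundPropagators, (3.128) p.421] -/
theorem equiv_frakGOfRecordAtBg128_star (h : SmallBelow (avOfRecord F N K) k U₀) (hGp : ∀ s, Gp (starW (phiRec N) s) = starW (phiRec N) (Gp s))
    (hΔ2 : ∀ x, Δ2 (starW (phiRec N) x) = starW (phiRec N) (Δ2 x)) (hQ : Function.Surjective (QOfRecord F N k U₀))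
    (f : NegSizeLit F N K k Ω 3) (b : Bond (F.P K).d (fun _ => (F.P K).sitesPerDir 0)) :
    JetSup.equiv _ _ (nabla115 ((F.P K).eta k) (unitsOfRecord F N U₀))
        (frakGOfRecordAtBg128 F N K k Ω U₀ Gp Δ2 a hposπ hQ ((NegSup.equiv _ _).symm (star (NegSup.equiv _ _ f)))) b =
      star (JetSup.equiv _ _ (nabla115 ((F.P K).eta k) (unitsOfRecord F N U₀)) (frakGOfRecordAtBg128 F N K k Ω U₀ Gp Δ2 a hposπ hQ f) b) :=
  equiv_frakGOfRecordAt_star F N k U₀ Ω hposπ h (hessOpOfRecord128_starW F N k U₀ hGp hΔ2) hQ f b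

/-- ★★ **SLOT (c): `H₁(U₀) = H1OfRecordAtBg128` IS REAL** for real `G′`, `Δ⁽²⁾`, under the guard (✓p821715 at the slot-(c) Hessian). [cite: Balaban1985Variational, (102)–(103) p.293] -/
theorem equiv_H1OfRecordAtBg128_star (levB : PBond (F.P K) k → ℕ) (h : SmallBelow (avOfRecord F N K) k U₀)
    (hGp : ∀ s, Gp (starW (phiRec N) s) = starW (phiRec N) (Gp s)) (hΔ2 : ∀ x, Δ2 (starW (phiRec N) x) = starW (phiRec N) (Δ2 x))
    (hQ : Function.Surjective (QOfRecord F N k U₀)) (B : NegSize (F.L : ℝ) ((F.P K).eta k) levB 0 (Matrix (Fin N) (Fin N) ℂ))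
    (b : Bond (F.P K).d (fun _ => (F.P K).sitesPerDir 0)) :
    JetSup.equiv _ _ (nabla115 ((F.P K).eta k) (unitsOfRecord F N U₀))
        (H1OfRecordAtBg128 F N K k Ω U₀ levB Gp Δ2 a hposπ hQ ((NegSup.equiv _ _).symm (star (NegSup.equiv _ _ B)))) b =
      star (JetSup.equiv _ _ (nabla115 ((F.P K).eta k) (unitsOfRecord F N U₀)) (H1OfRecordAtBg128 F N K k Ω U₀ levB Gp Δ2 a hposπ hQ B) b) :=
  equiv_H1OfRecordAt_star F N k U₀ Ω hposπ levB h (hessOpOfRecord128_starW F N k U₀ hGp hΔ2) hQ B b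

/-! ## §3  The log-coordinate `B(V)` and the shift `𝔄(V) = H₁B(V)` -/

omit [Fact (0 < c0Rec F K k)] [Fact (∀ c, 0 < wBRec F K k c)] [Fact (0 < (F.L : ℝ))] [Fact (0 < (F.P K).eta k)] in
/-- **`B(V)(c) = (1/i)·log(V(c)Ū^kU₀(c)⋆)` IS HERMITIAN** when the argument of `log` is within `1/4` of `1` (a unitary: both factors in `SU(N)`; lit
✓`B7Prop2Explicit.star_mlog_eq_neg`). [cite: Balaban1985Variational, (20) p.281; Balaban1985Averaging, (22)–(23) p.21] -/
theorem star_BOfRecord_apply (levB : PBond (F.P K) k → ℕ) (V : GaugeField (F.P K) k (SU N)) (c : PBond (F.P K) k)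
    (hV : ‖(V c : Matrix (Fin N) (Fin N) ℂ) * star (Averaging.iter (avOfRecord F N K) k U₀ c : Matrix (Fin N) (Fin N) ℂ) - 1‖ ≤ 1 / 4) :
    star (NegSup.equiv _ _ (BOfRecord F N K k U₀ levB V) c) = NegSup.equiv _ _ (BOfRecord F N K k U₀ levB V) c := by
  letI : CStarAlgebra (Matrix (Fin N) (Fin N) ℂ) := {}
  have hu : (V c : Matrix (Fin N) (Fin N) ℂ) * star (Averaging.iter (avOfRecord F N K) k U₀ c : Matrix (Fin N) (Fin N) ℂ) ∈ unitary (Matrix (Fin N) (Fin N) ℂ) := by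
    have hm := (Matrix.mem_specialUnitaryGroup_iff.mp (V c * (Averaging.iter (avOfRecord F N K) k U₀ c)⁻¹).2).1
    rwa [Submonoid.coe_mul, coe_inv_SU] at hm
  rw [BOfRecord_apply, star_smul, B7Prop2Explicit.star_mlog_eq_neg hu hV, Complex.star_def, map_inv₀, Complex.conj_I, inv_neg, neg_smul, smul_neg, neg_neg]

/-- ★★ **THE SHIFT `𝔄(V) = H₁B(V)` OF SLOT (c) HAS HERMITIAN JET** for real `G′`, `Δ⁽²⁾`, under the guard, when every `V(c)Ū(c)⋆` is within `1/4` of `1` (so `B(V)` is Hermitian and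
`H₁` real). [cite: Balaban1985Variational, (103) p.293, (20) p.281, (116) p.295] -/
theorem equiv_frakAOfRecordAtBg128_star (levB : PBond (F.P K) k → ℕ) (h : SmallBelow (avOfRecord F N K) k U₀)
    (hGp : ∀ s, Gp (starW (phiRec N) s) = starW (phiRec N) (Gp s)) (hΔ2 : ∀ x, Δ2 (starW (phiRec N) x) = starW (phiRec N) (Δ2 x))
    (hQ : Function.Surjective (QOfRecord F N k U₀)) (V : GaugeField (F.P K) k (SU N))
    (hV : ∀ c, ‖(V c : Matrix (Fin N) (Fin N) ℂ) * star (Averaging.iter (avOfRecord F N K) k U₀ c : Matrix (Fin N) (Fin N) ℂ) - 1‖ ≤ 1 / 4)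
    (b : Bond (F.P K).d (fun _ => (F.P K).sitesPerDir 0)) :
    star (JetSup.equiv _ _ (nabla115 ((F.P K).eta k) (unitsOfRecord F N U₀)) (frakAOfRecordAtBg128 F N K k Ω U₀ levB Gp Δ2 a hposπ hQ V) b) =
      JetSup.equiv _ _ (nabla115 ((F.P K).eta k) (unitsOfRecord F N U₀)) (frakAOfRecordAtBg128 F N K k Ω U₀ levB Gp Δ2 a hposπ hQ V) b := by
  have hB : ((NegSup.equiv _ _).symm (star (NegSup.equiv _ _ (BOfRecord F N K k U₀ levB V))) : NegSize (F.L : ℝ) ((F.P K).eta k) levB 0 (Matrix (Fin N) (Fin N) ℂ)) =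
      BOfRecord F N K k U₀ levB V := by
    apply (NegSup.equiv _ _).injective
    rw [Equiv.apply_symm_apply]
    funext c
    rw [Pi.star_apply, star_BOfRecord_apply F N k U₀ levB V c (hV c)]
  rw [frakAOfRecordAtBg128_eq, ← equiv_H1OfRecordAtBg128_star F N k U₀ Ω hposπ levB h hGp hΔ2 hQ, hB]

end SlotC

end Summit.QuantumFields.YangMills.Theorems.N07FrakGOfRecordReality

end
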